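import Mathlib.NumberTheory.Bertrand
import Mathlib.Analysis.Complex.ExponentialBounds
import Literature.NumberTheory.LFunctions.RobinCounterexampleSuperabundant
import Literature.NumberTheory.LFunctions.RobinNumerical
import Literature.NumberTheory.Multiplicative.PerfectNumbers
import HarnessLib

/-!
# Alaoglu–Erdős structure of large superabundant numbers (support file of route `RobinFullPortrait`)

Route-independent support file (NO `Theses` import; reusable by any Robin-type route) for item
stmt-RiemannHypothesis-24269 (`RobinFullPortrait.Portrait`, CLOSED·proved by `portrait_proof`); consumed by
`Theorems/RobinFullPortraitSharp.lean`.  Everything here is RH-free, print-free and elementary — the 1944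
exchange arguments of Alaoglu–Erdős for superabundant (SA) numbers `n` (`σ(m)/m < σ(n)/n` for all `m < n`),
with no numerics beyond `e > 2.718`:

* `le_pow_factorization_succ` (Alaoglu–Erdős 1944 §2 Thm 1; Nazardonyavi–Yakubovich 2012 Thm 4.4,
  `⌊log p / log q⌋ ≤ k_q`): `p ∣ n` prime, `q` any prime ⇒ `p ≤ q^(k_q + 1)` (competitor `m = n q^(k_q+1)/p`).
  Hence every prime below a prime factor of `n` divides `n` (`dvd_of_prime_lt`).
* `pow_factorization_le_sq` (same exchange, competitor `m = n p'/q^(c+1)` with `q^c ≤ p' < q^(c+1)`): for a prime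
  `p' ∤ n`, every `q^(k_q) ∥ n` has `q^(k_q) ≤ p'²` (A–E Thm 3 has the sharper `q^(k_q) < 2^(k₂+2)`).
* `log_le_of_superabundant`: with `P = P(n)` the largest prime factor and Bertrand's prime `p' ∈ (P, 2P]`,
  `n ≤ (p'²)^ω(n) ≤ ((2P)²)^(P−1)`, i.e. `log n ≤ (P − 1)·2 log(2P)` (crude form of A–E Thm 7, `P ∼ log n`).
* `exists_large_prime_factor`, `two_pow_56_dvd`, `prime_dvd_of_le_ten_pow_17`: an SA number with
  `log n > 0.99947·(10¹⁹ − 1)` has `P(n) > 10¹⁷` (as `(10¹⁷ − 1)·80 < 9.99·10¹⁸`, `log(2·10¹⁷) ≤ 40`), hence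
  `2^56 ∣ n` (`P ≤ 2^(k₂+1)`, `2^56 < 10¹⁷`) and every prime `≤ 10¹⁷` divides `n`.

Nothing here bears on the truth of RH.  A rung is not RH; RH is NOT proved by this file or this route.
Sources: [AlaogluErdos1944, §2 Thms 1–3, 7, Lemma 1; doi:10.1090/s0002-9947-1944-0011087-2],
[NazardonyaviYakubovich2012 = arXiv:1211.2147, Thm 4.4, Prop 4.3, Prop 4.13, Prop 4.15, Rem 4.8],
Mathlib `Nat.exists_prime_lt_and_le_two_mul` (Bertrand–Chebyshev).
Route lead rlead-rh-RobinFullPortrait g2 (D-0172/D-0179) filing.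
-/

set_option linter.dupNamespace false  -- the mandated namespace repeats `RiemannHypothesis`

namespace Summit.RiemannHypothesis.RiemannHypothesis.Theorems.RobinFullPortrait

open Real Finset
open scoped ArithmeticFunction.sigma

/-! ## §1 Values of `σ` on prime powers -/

-- Reused from the tree: `RobinCheck.sigma_prime_pow_succ'` (`σ(q^(a+1)) = σ(q^a) + q^(a+1)`),
-- `PerfectNumbers.sigma_one_prime` (`σ(q) = q + 1`), `Nat.one_le_sigma_one`, `Nat.sigma_one_prime_pow_succ`.

/-- Splitting a geometric sum: `σ(q^(a+b+1)) = σ(q^a) + q^(a+1) σ(q^b)`. [folklore] -/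
theorem sigma_prime_pow_split {q : ℕ} (hq : q.Prime) (a b : ℕ) :
    σ 1 (q ^ (a + b + 1)) = σ 1 (q ^ a) + q ^ (a + 1) * σ 1 (q ^ b) := by
  induction b with
  | zero =>
    rw [pow_zero, ArithmeticFunction.isMultiplicative_sigma.map_one, mul_one, add_zero]
    exact Literature.NumberTheory.LFunctions.RobinCheck.sigma_prime_pow_succ' hq a
  | succ b ih =>
    rw [show a + (b + 1) + 1 = (a + b + 1) + 1 by ring,
      Literature.NumberTheory.LFunctions.RobinCheck.sigma_prime_pow_succ' hq (a + b + 1), ih,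
      Literature.NumberTheory.LFunctions.RobinCheck.sigma_prime_pow_succ' hq b]
    ring

/-- `(q − 1) σ(q^a) + 1 = q^(a+1)` (the geometric sum, in `ℤ`). [folklore] -/
theorem sigma_prime_pow_mul_pred {q : ℕ} (hq : q.Prime) (a : ℕ) :
    ((σ 1 (q ^ a) : ℕ) : ℤ) * ((q : ℤ) - 1) = (q : ℤ) ^ (a + 1) - 1 := by
  induction a with
  | zero => simp [ArithmeticFunction.isMultiplicative_sigma.map_one]
  | succ a ih =>
    rw [Literature.NumberTheory.LFunctions.RobinCheck.sigma_prime_pow_succ' hq a]; push_cast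
    rw [add_mul, ih]; ring

/-! ## §2 Alaoglu–Erdős exchange inequalities for superabundant numbers -/

/-- The defining inequality of a superabundant number, cross-multiplied in `ℕ`.
[cite: AkbaryFriggstad2009, p. 273] -/
theorem sa_mul_lt {n m : ℕ} (hn : Nat.Superabundant n) (hm : 1 ≤ m) (hmn : m < n) :
    σ 1 m * n < σ 1 n * m := by
  have h := hn.lt hm hmn
  have hm0 : (0 : ℝ) < m := by exact_mod_cast hm
  have hn0 : (0 : ℝ) < n := by exact_mod_cast (lt_of_lt_of_le (by norm_num) (le_trans hm hmn.le))
  rw [div_lt_div_iff₀ hm0 hn0] at h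
  exact_mod_cast h

/-- **Alaoglu–Erdős 1944 §2 (Thm 1 / Lemma) = Nazardonyavi–Yakubovich Thm 4.4** (`⌊log p/log q⌋ ≤ k_q`):
if `n` is superabundant, `p` is a prime factor of `n` and `q` is ANY prime, then `p ≤ q^(k_q+1)` where
`k_q = n.factorization q`.  Proof: otherwise `m = n q^(k_q+1)/p < n` has `σ(m)/m ≥ σ(n)/n`.
[cite: AlaogluErdos1944, §2 Thm 1; arXiv:1211.2147, Thm 4.4] -/
theorem le_pow_factorization_succ {n p q : ℕ} (hn : Nat.Superabundant n) (hp : p.Prime) (hpn : p ∣ n)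
    (hq : q.Prime) : p ≤ q ^ (n.factorization q + 1) := by
  have hn0 : n ≠ 0 := by have := hn.one_le; omega
  by_contra hlt
  push Not at hlt
  set k := n.factorization q with hk
  have hqp : q ≠ p := by
    rintro rfl
    exact absurd hlt (not_lt.2 (le_trans (le_of_eq (pow_one q).symm) (Nat.pow_le_pow_right hq.pos (by omega))))
  -- `n = q^k · n₁` with `q ∤ n₁`
  set n₁ := ordCompl[q] n with hn₁
  have hdec₁ : q ^ k * n₁ = n := Nat.ordProj_mul_ordCompl_eq_self n q
  have hqn₁ : ¬ q ∣ n₁ := Nat.not_dvd_ordCompl hq hn0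
  have hn₁0 : n₁ ≠ 0 := by
    intro h; apply hn0; rw [← hdec₁, h, mul_zero]
  have hpn₁ : p ∣ n₁ := by
    have hcop : Nat.Coprime p (q ^ k) := ((Nat.coprime_primes hp hq).2 hqp.symm).pow_right k
    have : p ∣ q ^ k * n₁ := by rw [hdec₁]; exact hpn
    exact hcop.dvd_of_dvd_mul_left this
  -- `n₁ = p^(i+1) · r` with `p ∤ r`
  set j := n₁.factorization p with hj
  set r := ordCompl[p] n₁ with hr
  have hdec₂ : p ^ j * r = n₁ := Nat.ordProj_mul_ordCompl_eq_self n₁ p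
  have hpr : ¬ p ∣ r := Nat.not_dvd_ordCompl hp hn₁0
  have hr0 : r ≠ 0 := by
    intro h; apply hn₁0; rw [← hdec₂, h, mul_zero]
  have hj1 : 1 ≤ j := hp.factorization_pos_of_dvd hn₁0 hpn₁
  obtain ⟨i, hji⟩ : ∃ i, j = i + 1 := ⟨j - 1, by omega⟩
  have hdec : n = q ^ k * (p ^ (i + 1) * r) := by rw [← hji, hdec₂, hdec₁]
  -- the competitor `m = q^(2k+1) · p^i · r < n`
  have hrpos : 0 < r := Nat.pos_of_ne_zero hr0
  have hpos : 0 < q ^ k * (p ^ i * r) := Nat.mul_pos (pow_pos hq.pos _) (Nat.mul_pos (pow_pos hp.pos _) hrpos)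
  have hm_lt : q ^ (2 * k + 1) * (p ^ i * r) < n := by
    rw [hdec]
    have e1 : q ^ (2 * k + 1) * (p ^ i * r) = (q ^ k * (p ^ i * r)) * q ^ (k + 1) := by ring
    have e2 : q ^ k * (p ^ (i + 1) * r) = (q ^ k * (p ^ i * r)) * p := by ring
    rw [e1, e2]
    exact (Nat.mul_lt_mul_left hpos).2 hlt
  have hm1 : 1 ≤ q ^ (2 * k + 1) * (p ^ i * r) :=
    Nat.succ_le_of_lt (Nat.mul_pos (pow_pos hq.pos _) (Nat.mul_pos (pow_pos hp.pos _) hrpos))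
  have h := sa_mul_lt hn hm1 hm_lt
  rw [hdec] at h
  -- coprimality bookkeeping
  have hq_pir : ¬ q ∣ p ^ (i + 1) * r := by rw [← hji, hdec₂]; exact hqn₁
  have hq_pir' : ¬ q ∣ p ^ i * r := fun hd =>
    hq_pir (hd.trans (mul_dvd_mul_right (pow_dvd_pow p (Nat.le_succ i)) r))
  have c1 : Nat.Coprime (q ^ k) (p ^ (i + 1) * r) := ((Nat.Prime.coprime_iff_not_dvd hq).2 hq_pir).pow_left k
  have c2 : Nat.Coprime (p ^ (i + 1)) r := ((Nat.Prime.coprime_iff_not_dvd hp).2 hpr).pow_left _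
  have c3 : Nat.Coprime (q ^ (2 * k + 1)) (p ^ i * r) :=
    ((Nat.Prime.coprime_iff_not_dvd hq).2 hq_pir').pow_left _
  have c4 : Nat.Coprime (p ^ i) r := ((Nat.Prime.coprime_iff_not_dvd hp).2 hpr).pow_left _
  have hσ := ArithmeticFunction.isMultiplicative_sigma (k := 1)
  rw [hσ.map_mul_of_coprime c1, hσ.map_mul_of_coprime c2, hσ.map_mul_of_coprime c3,
    hσ.map_mul_of_coprime c4, show 2 * k + 1 = k + k + 1 by ring, sigma_prime_pow_split hq k k,
    Nat.sigma_one_prime_pow_succ hp i] at h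
  -- `h : (σ(q^k) + q^(k+1) σ(q^k)) (σ(p^i) σ(r)) (q^k (p^(i+1) r)) < σ(q^k) ((p σ(p^i) + 1) σ(r)) (q^(k+k+1) (p^i r))`
  set A := σ 1 (q ^ k) with hA
  set S := σ 1 (p ^ i) with hS
  set R := σ 1 r with hR
  have hA1 : 1 ≤ A := Nat.one_le_sigma_one (pow_ne_zero _ hq.ne_zero)
  have hS1 : 1 ≤ S := Nat.one_le_sigma_one (pow_ne_zero _ hp.ne_zero)
  have hR1 : 1 ≤ R := Nat.one_le_sigma_one hr0
  have eL : (A + q ^ (k + 1) * A) * (S * R) * (q ^ k * (p ^ (i + 1) * r)) =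
      (A * R * (q ^ k * (p ^ i * r))) * (S * p * (1 + q ^ (k + 1))) := by ring
  have eR : A * ((p * S + 1) * R) * (q ^ (k + k + 1) * (p ^ i * r)) =
      (A * R * (q ^ k * (p ^ i * r))) * ((p * S + 1) * q ^ (k + 1)) := by ring
  rw [eL, eR] at h
  have h' : S * p * (1 + q ^ (k + 1)) < (p * S + 1) * q ^ (k + 1) := Nat.lt_of_mul_lt_mul_left h
  have h5 : S * p < q ^ (k + 1) := by nlinarith [h']
  have h6 : p ≤ S * p := Nat.le_mul_of_pos_left p hS1
  exact absurd (lt_trans (lt_of_le_of_lt h6 h5) hlt) (lt_irrefl p)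

/-- Corollary (Alaoglu–Erdős 1944, §2: the primes dividing an SA number form an initial segment):
every prime below a prime factor of a superabundant `n` divides `n`.
[cite: AlaogluErdos1944, §2 Thm 1; arXiv:1211.2147, Thm 4.4] -/
theorem dvd_of_prime_lt {n p q : ℕ} (hn : Nat.Superabundant n) (hp : p.Prime) (hpn : p ∣ n)
    (hq : q.Prime) (hqp : q < p) : q ∣ n := by
  have hn0 : n ≠ 0 := by have := hn.one_le; omega
  have hA := le_pow_factorization_succ hn hp hpn hq
  have hk : 1 ≤ n.factorization q := by
    by_contra h0
    have h00 : n.factorization q = 0 := by omega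
    rw [h00, zero_add, pow_one] at hA
    omega
  simpa using (hq.pow_dvd_iff_le_factorization hn0).2 hk

/-- **Alaoglu–Erdős exchange, upper side**: if `n` is superabundant and `p'` is a prime NOT dividing `n`,
then every prime power exactly dividing `n` is at most `p'²`.  Proof: with `q^(c) ≤ p' < q^(c+1)` and
`k_q = c + 1 + d`, the competitor `m = n p'/q^(c+1) < n` forces `q^(d+1) ≤ p'`.
(A–E Thm 3 has the sharper `q^(k_q) < 2^(k_2 + 2)`.)
[cite: AlaogluErdos1944, §2 Thms 2–3; arXiv:1211.2147, Prop 4.3, Rem 4.8] -/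
theorem pow_factorization_le_sq {n p' q : ℕ} (hn : Nat.Superabundant n) (hp' : p'.Prime)
    (hp'n : ¬ p' ∣ n) (hq : q.Prime) : q ^ n.factorization q ≤ p' ^ 2 := by
  have hn0 : n ≠ 0 := by have := hn.one_le; omega
  set k := n.factorization q with hk
  set c := Nat.log q p' with hc
  have hc1 : p' < q ^ (c + 1) := Nat.lt_pow_succ_log_self hq.one_lt p'
  have hc2 : q ^ c ≤ p' := Nat.pow_log_le_self q hp'.ne_zero
  have hp'1 : p' ≤ p' ^ 2 := by nlinarith [hp'.two_le]
  by_cases hkc : k ≤ c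
  · exact le_trans (Nat.pow_le_pow_right hq.pos hkc) (le_trans hc2 hp'1)
  push Not at hkc
  obtain ⟨d, hd⟩ : ∃ d, k = c + d + 1 := ⟨k - (c + 1), by omega⟩
  -- `n = q^k · r`, `q ∤ r`, `p' ∤ r`, `p' ≠ q`
  set r := ordCompl[q] n with hr
  have hdec : q ^ k * r = n := Nat.ordProj_mul_ordCompl_eq_self n q
  have hqr : ¬ q ∣ r := Nat.not_dvd_ordCompl hq hn0
  have hr0 : r ≠ 0 := by
    intro h; apply hn0; rw [← hdec, h, mul_zero]
  have hp'r : ¬ p' ∣ r := fun h => hp'n (h.trans ⟨q ^ k, by rw [← hdec, mul_comm]⟩)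
  have hp'q : p' ≠ q := by
    rintro rfl
    exact hp'n ⟨p' ^ (c + d) * r, by rw [← hdec, hd]; ring⟩
  -- competitor `m = q^d · p' · r < n`
  have hrpos : 0 < r := Nat.pos_of_ne_zero hr0
  have hpos : 0 < q ^ d * r := Nat.mul_pos (pow_pos hq.pos _) hrpos
  have hm_lt : q ^ d * (p' * r) < n := by
    rw [← hdec, hd]
    have e1 : q ^ (c + d + 1) * r = (q ^ d * r) * q ^ (c + 1) := by ring
    have e2 : q ^ d * (p' * r) = (q ^ d * r) * p' := by ring
    rw [e1, e2]
    exact (Nat.mul_lt_mul_left hpos).2 hc1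
  have hm1 : 1 ≤ q ^ d * (p' * r) := Nat.succ_le_of_lt (Nat.mul_pos (pow_pos hq.pos _) (Nat.mul_pos hp'.pos hrpos))
  have h := sa_mul_lt hn hm1 hm_lt
  rw [← hdec, hd] at h
  -- coprimality bookkeeping
  have hq_p'r : ¬ q ∣ p' * r := fun hdv => by
    rcases (Nat.Prime.dvd_mul hq).1 hdv with h1 | h1
    · exact hp'q ((Nat.prime_dvd_prime_iff_eq hq hp').1 h1).symm
    · exact hqr h1
  have c1 : Nat.Coprime (q ^ d) (p' * r) := ((Nat.Prime.coprime_iff_not_dvd hq).2 hq_p'r).pow_left d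
  have c2 : Nat.Coprime p' r := (Nat.Prime.coprime_iff_not_dvd hp').2 hp'r
  have c3 : Nat.Coprime (q ^ (c + d + 1)) r := ((Nat.Prime.coprime_iff_not_dvd hq).2 hqr).pow_left _
  have hσ := ArithmeticFunction.isMultiplicative_sigma (k := 1)
  rw [hσ.map_mul_of_coprime c1, hσ.map_mul_of_coprime c2, hσ.map_mul_of_coprime c3,
    Literature.NumberTheory.Multiplicative.PerfectNumbers.sigma_one_prime hp'] at h
  -- `h : σ(q^d) ((p'+1) σ r) (q^(c+d+1) r) < σ(q^(c+d+1)) σ(r) (q^d (p' r))`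
  set D := σ 1 (q ^ d) with hD
  set K := σ 1 (q ^ (c + d + 1)) with hK
  set R := σ 1 r with hR
  have hR1 : 1 ≤ R := Nat.one_le_sigma_one hr0
  have eL : D * ((p' + 1) * R) * (q ^ (c + d + 1) * r) = (R * (q ^ d * r)) * (D * (p' + 1) * q ^ (c + 1)) := by
    ring
  have eR : K * R * (q ^ d * (p' * r)) = (R * (q ^ d * r)) * (K * p') := by ring
  rw [eL, eR] at h
  have h' : D * (p' + 1) * q ^ (c + 1) < K * p' := Nat.lt_of_mul_lt_mul_left h
  -- pass to `ℤ` and use the closed forms `(q-1) D = q^(d+1) - 1`, `(q-1) K = q^(c+d+2) - 1`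
  have hDz : ((D : ℕ) : ℤ) * ((q : ℤ) - 1) = (q : ℤ) ^ (d + 1) - 1 := sigma_prime_pow_mul_pred hq d
  have hKz : ((K : ℕ) : ℤ) * ((q : ℤ) - 1) = (q : ℤ) ^ (c + d + 1 + 1) - 1 := sigma_prime_pow_mul_pred hq _
  have hq1 : (0 : ℤ) < (q : ℤ) - 1 := by have := hq.two_le; omega
  have h'z : ((D : ℕ) : ℤ) * ((p' : ℤ) + 1) * (q : ℤ) ^ (c + 1) < ((K : ℕ) : ℤ) * (p' : ℤ) := by
    exact_mod_cast h'
  have hz : ((q : ℤ) ^ (d + 1) - 1) * (((p' : ℤ) + 1) * (q : ℤ) ^ (c + 1)) <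
      ((q : ℤ) ^ (c + d + 1 + 1) - 1) * (p' : ℤ) := by
    calc ((q : ℤ) ^ (d + 1) - 1) * (((p' : ℤ) + 1) * (q : ℤ) ^ (c + 1))
        = (((D : ℕ) : ℤ) * ((p' : ℤ) + 1) * (q : ℤ) ^ (c + 1)) * ((q : ℤ) - 1) := by rw [← hDz]; ring
      _ < (((K : ℕ) : ℤ) * (p' : ℤ)) * ((q : ℤ) - 1) := mul_lt_mul_of_pos_right h'z hq1
      _ = ((q : ℤ) ^ (c + d + 1 + 1) - 1) * (p' : ℤ) := by rw [← hKz]; ring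
  have hQ : (0 : ℤ) < (q : ℤ) ^ (c + 1) := pow_pos (by exact_mod_cast hq.pos) _
  have hp'0 : (0 : ℤ) ≤ (p' : ℤ) := by positivity
  have epow : (q : ℤ) ^ (c + d + 1 + 1) = (q : ℤ) ^ (d + 1) * (q : ℤ) ^ (c + 1) := by ring
  rw [epow] at hz
  -- `hz : (Q' - 1) (p'+1) Q < (Q' Q - 1) p'` with `Q' = q^(d+1)`, `Q = q^(c+1)`; hence `Q' Q < (p'+1) Q`
  have hlin : (q : ℤ) ^ (d + 1) * (q : ℤ) ^ (c + 1) < ((p' : ℤ) + 1) * (q : ℤ) ^ (c + 1) := by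
    nlinarith [hz, hQ, hp'0]
  have hlt : (q : ℤ) ^ (d + 1) < (p' : ℤ) + 1 := lt_of_mul_lt_mul_right hlin hQ.le
  have hle : q ^ (d + 1) ≤ p' := by
    have : (q : ℤ) ^ (d + 1) ≤ (p' : ℤ) := Int.lt_add_one_iff.1 hlt
    exact_mod_cast this
  calc q ^ k = q ^ (d + 1) * q ^ c := by rw [hd]; ring
    _ ≤ p' * p' := Nat.mul_le_mul hle hc2
    _ = p' ^ 2 := (sq p').symm

/-! ## §3 Size of a superabundant number in terms of its largest prime factor -/

/-- If `n ≥ 2` is superabundant with largest prime factor `P`, then `log n ≤ (P − 1) · 2 log(2P)`: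
Bertrand gives a prime `p' ∈ (P, 2P]` not dividing `n`, every one of the `ω(n) ≤ P − 1` prime powers of `n`
is `≤ p'² ≤ (2P)²`.  (Crude form of Alaoglu–Erdős Thm 7 `P ∼ log n` / N–Y Prop 4.15.)
[cite: AlaogluErdos1944, §2 Thm 7; arXiv:1211.2147, Prop 4.13, Prop 4.15] -/
theorem log_le_of_superabundant {n : ℕ} (hn : Nat.Superabundant n) (h2 : 2 ≤ n) :
    ∃ P : ℕ, P.Prime ∧ P ∣ n ∧ (∀ q ∈ n.primeFactors, q ≤ P) ∧
      Real.log n ≤ ((P : ℝ) - 1) * (2 * Real.log (2 * P)) := by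
  have hn0 : n ≠ 0 := by omega
  have hne : n.primeFactors.Nonempty := Nat.nonempty_primeFactors.2 (by omega)
  set P := n.primeFactors.max' hne with hP
  have hPmem : P ∈ n.primeFactors := Finset.max'_mem _ _
  have hPp : P.Prime := Nat.prime_of_mem_primeFactors hPmem
  have hPn : P ∣ n := Nat.dvd_of_mem_primeFactors hPmem
  have hle : ∀ q ∈ n.primeFactors, q ≤ P := fun q hq => Finset.le_max' _ q hq
  refine ⟨P, hPp, hPn, hle, ?_⟩
  obtain ⟨p', hp', hPp', hp'2⟩ := Nat.exists_prime_lt_and_le_two_mul P hPp.ne_zero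
  have hp'n : ¬ p' ∣ n := fun h =>
    absurd (hle p' (Nat.mem_primeFactors.2 ⟨hp', h, hn0⟩)) (not_le.2 hPp')
  have hpow : ∀ q ∈ n.primeFactors, q ^ n.factorization q ≤ p' ^ 2 := fun q hq =>
    pow_factorization_le_sq hn hp' hp'n (Nat.prime_of_mem_primeFactors hq)
  have hprod : n ≤ (p' ^ 2) ^ n.primeFactors.card := by
    calc n = ∏ q ∈ n.primeFactors, q ^ n.factorization q := Nat.prod_primeFactors_pow_factorization hn0
      _ ≤ ∏ q ∈ n.primeFactors, p' ^ 2 := Finset.prod_le_prod (fun _ _ => Nat.zero_le _) hpow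
      _ = (p' ^ 2) ^ n.primeFactors.card := Finset.prod_const _
  have hcard : n.primeFactors.card ≤ P - 1 := by
    have hsub : n.primeFactors ⊆ Finset.Icc 2 P := fun q hq =>
      Finset.mem_Icc.2 ⟨(Nat.prime_of_mem_primeFactors hq).two_le, hle q hq⟩
    calc n.primeFactors.card ≤ (Finset.Icc 2 P).card := Finset.card_le_card hsub
      _ = P + 1 - 2 := Nat.card_Icc 2 P
      _ = P - 1 := by omega
  have hn_le : n ≤ ((2 * P) ^ 2) ^ (P - 1) := by
    calc n ≤ (p' ^ 2) ^ n.primeFactors.card := hprod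
      _ ≤ (p' ^ 2) ^ (P - 1) := Nat.pow_le_pow_right (pow_pos hp'.pos 2) hcard
      _ ≤ ((2 * P) ^ 2) ^ (P - 1) := Nat.pow_le_pow_left (Nat.pow_le_pow_left hp'2 2) _
  have hcast : (n : ℝ) ≤ (((2 * P : ℕ) : ℝ) ^ 2) ^ (P - 1) := by exact_mod_cast hn_le
  have hnpos : (0 : ℝ) < n := by exact_mod_cast (show 0 < n by omega)
  calc Real.log n ≤ Real.log ((((2 * P : ℕ) : ℝ) ^ 2) ^ (P - 1)) := Real.log_le_log hnpos hcast
    _ = ((P - 1 : ℕ) : ℝ) * (2 * Real.log (2 * P)) := by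
        rw [Real.log_pow, Real.log_pow]; push_cast; ring
    _ = ((P : ℝ) - 1) * (2 * Real.log (2 * P)) := by
        rw [Nat.cast_sub hPp.one_le]; push_cast; ring

/-- `log(2·10¹⁷) ≤ 40` (from `e > 2.718`, `2.718^40 > 2·10¹⁷`). [folklore] -/
theorem log_two_mul_ten_pow_17_le : Real.log (2 * 10 ^ 17) ≤ 40 := by
  have he : (2.718 : ℝ) ≤ Real.exp 1 := (lt_trans (by norm_num) Real.exp_one_gt_d9).le
  have h40 : (2.718 : ℝ) ^ 40 ≤ Real.exp 1 ^ 40 := pow_le_pow_left₀ (by norm_num) he 40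
  have h3 : Real.exp 1 ^ 40 = Real.exp 40 := by
    rw [← Real.exp_nat_mul]; norm_num
  have h1 : (2 * 10 ^ 17 : ℝ) ≤ Real.exp 40 := by
    calc (2 * 10 ^ 17 : ℝ) ≤ 2.718 ^ 40 := by norm_num
      _ ≤ Real.exp 1 ^ 40 := h40
      _ = Real.exp 40 := h3
  exact (Real.log_le_iff_le_exp (by positivity)).2 h1

/-- A superabundant number with `log n > 0.99947·(10¹⁹ − 1)` has a prime factor `> 10¹⁷` (namely its
largest one).  RH-free, print-free. [cite: AlaogluErdos1944, §2 Thm 7; arXiv:1211.2147, Prop 4.15] -/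
theorem exists_large_prime_factor {n : ℕ} (hn : Nat.Superabundant n)
    (hlog : 0.99947 * ((10 : ℝ) ^ 19 - 1) < Real.log n) :
    ∃ P : ℕ, P.Prime ∧ P ∣ n ∧ 10 ^ 17 < P ∧ ∀ q ∈ n.primeFactors, q ≤ P := by
  have h2 : 2 ≤ n := by
    by_contra h
    have hlog0 : Real.log n ≤ 0 := by
      interval_cases n <;> simp
    linarith
  obtain ⟨P, hPp, hPn, hle, hlogle⟩ := log_le_of_superabundant hn h2
  refine ⟨P, hPp, hPn, ?_, hle⟩
  by_contra hP
  push Not at hP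
  have hPR : (P : ℝ) ≤ 10 ^ 17 := by exact_mod_cast hP
  have hP2 : (2 : ℝ) ≤ P := by exact_mod_cast hPp.two_le
  have hlog2P : Real.log (2 * P) ≤ 40 :=
    le_trans (Real.log_le_log (by linarith) (by linarith)) log_two_mul_ten_pow_17_le
  have hlog2P0 : 0 ≤ Real.log (2 * P) := Real.log_nonneg (by linarith)
  have hbd : Real.log n ≤ (10 ^ 17 - 1) * (2 * 40) :=
    le_trans hlogle (mul_le_mul (by linarith) (by linarith) (by linarith) (by norm_num))
  linarith

/-- **`2^56` divides every superabundant number with `log n > 0.99947·(10¹⁹ − 1)`** (RH-free, print-free):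
`P(n) > 10¹⁷ > 2^56` and `P(n) ≤ 2^(k₂ + 1)` (Alaoglu–Erdős).  This supersedes the route's `t = 26` leg
(`2^26 ∣ N`) for the portrait. [cite: AlaogluErdos1944, §2 Thm 1; arXiv:1211.2147, Thm 4.4] -/
theorem two_pow_56_dvd {n : ℕ} (hn : Nat.Superabundant n)
    (hlog : 0.99947 * ((10 : ℝ) ^ 19 - 1) < Real.log n) : 2 ^ 56 ∣ n := by
  have hn0 : n ≠ 0 := by have := hn.one_le; omega
  obtain ⟨P, hPp, hPn, hP17, -⟩ := exists_large_prime_factor hn hlog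
  have hA := le_pow_factorization_succ hn hPp hPn Nat.prime_two
  have h56 : 2 ^ 56 < 2 ^ (n.factorization 2 + 1) :=
    lt_of_lt_of_le (lt_trans (by norm_num) hP17) hA
  have hk : 56 ≤ n.factorization 2 := by
    have := (Nat.pow_lt_pow_iff_right (by norm_num : 1 < 2)).1 h56
    omega
  exact (Nat.prime_two.pow_dvd_iff_le_factorization hn0).2 hk

/-- Every prime `q ≤ 10¹⁷` divides a superabundant number with `log n > 0.99947·(10¹⁹ − 1)`.
[cite: AlaogluErdos1944, §2 Thm 1; arXiv:1211.2147, Thm 4.4] -/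
theorem prime_dvd_of_le_ten_pow_17 {n q : ℕ} (hn : Nat.Superabundant n)
    (hlog : 0.99947 * ((10 : ℝ) ^ 19 - 1) < Real.log n) (hq : q.Prime) (hq17 : q ≤ 10 ^ 17) : q ∣ n := by
  obtain ⟨P, hPp, hPn, hP17, -⟩ := exists_large_prime_factor hn hlog
  exact dvd_of_prime_lt hn hPp hPn hq (lt_of_le_of_lt hq17 hP17)

end Summit.RiemannHypothesis.RiemannHypothesis.Theorems.RobinFullPortrait
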